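import Summits.BirchSwinnertonDyer.Rank1Residual.Additive.XSplitMultRankZeroCyclotomicThree
import Summits.BirchSwinnertonDyer.Rank1Residual.Additive.XMultRankZeroCyclotomicThreeFacts
import Literature.NumberTheory.EllipticCurves.Wuthrich2014.ReducibleSplitMultiplicativeDivisibilityCyclotomicThree
import Literature.NumberTheory.EllipticCurves.Greenberg1999.EulerCharacteristicNumberFieldSplitMultiplicative
import Literature.NumberTheory.EllipticCurves.PAdicHeightsLInvariantHoldsProofs
import Literature.NumberTheory.EllipticCurves.PAdicHeightsProofs
import Literature.NumberTheory.EllipticCurves.PAdicBSDSplitMultiplicativeProofs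
import HarnessLib

/-!
# X3 (M)-rows at `p = 3`, `V` SPLIT multiplicative: line V16 FROM NAMED FACTS ONLY
# (`K = ℚ(ζ₃)` instantiated; the exceptional zero handled by Greenberg–Stevens; unit rows ⇒ `BSD(W,3) ∧ BSD(V,3)`)

HONEST FRAMING (cell `b2b-bsdres`, run/shared/lean/b2b/bsd-rank1-residual/, verbatim in every
file): the goal of the cell is to DELETE the COMBINATION-SHAPED residual classes of the
Birch–Swinnerton-Dyer formula for ALL analytic-rank `≤ 1` elliptic curves over `ℚ` — "full BSD
formula for every rank `≤ 1` curve in class `C`" assembled STRICTLY from published theorems — so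
that the rank-`≤ 1` remainder becomes exactly the CONSTRUCTION-SHAPED classes, which are TYPED
(missing-input `Prop`s), NOT attempted. This is not "finishing BSD". Seat additive-p4 (research route
on X3/X4), gen 6; the labels of X3/X4 are UNCHANGED by this file; nothing is booked here (referee).

Theorems only (no `def`, no `sorry`, no new named fact). The inline hypotheses of the core theorem
`XSplitMultCyclotomicThree.exists_padicVal_shaOrder_add_le` (`XSplitMultRankZeroCyclotomicThree.lean`) are
DISCHARGED from named published facts and tree theorems:
* §1 `XSplitMultCyclotomicThree.greenbergK_of_fact` — `hGrK` from Greenberg LNM 1716 pp. 112–113 at a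
  SPLIT prime (named fact `Greenberg1999.thm41Analogue_charValue_rankZero_split_baseChange`, base-change
  specialisation: `l_𝔭 = 𝓛₃(V)/(2·3)`) via the `K`-side data of `CyclotomicThreeSplitMultiplicativeReduction`
  (`V_K` split multiplicative at `𝔭 = (ζ₃ − 1)`, `3 ∤ [K_𝔭:ℚ₃] = 2`) and `log₃ q_V ≠ 0` (from the tree
  THEOREM `LInvariant_ne_zero_holds`, Barré-Sirieix–Diaz–Gramain–Philibert);
* §2 the two tame branches at the split prime: even `L(0) = 0`, `[T¹]L·log₃γ = 𝓛₃(V)·[0]⁺_f`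
  (Greenberg–Stevens = named fact `greenberg_stevens V 3`, Kobayashi 2006 Cor. 4.2; `e⁺ = 1`), odd
  `L⁻₃(f,1,ω¹,0) = ∑(a/3)[a/3]⁻_f` (`constantCoeff_padicLFunctionMinusBranchMult_half_of_split`, the one-term
  measure with `α = a₃ = +1`; `e⁻ = 1`);
* §3 X3: `XSplitMultCyclotomicThree.exists_padicVal_shaOrder_add_le_of_facts_of_red` — `V[3]` REDUCIBLE,
  divisibility = Wuthrich 2014 Thm. 16 SPLIT clause at `3` over `ℚ(ζ₃)` (named fact
  `Wuthrich2014.thm16_charIdeal_dvd_splitMultiplicative_cyclotomicThree`); upper half;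
  `BSD(W,3) ∧ BSD(V,3)` on doubly-unit rows; Cassels–Tate squeeze. X4 in the sibling X4 file.

Published inputs, nothing else: the Wuthrich reading-fact, Greenberg's split display, Greenberg–Stevens,
Milne 1972 (`hMilne`), modularity (`hmod`, `hmodD`), GZK (`hGZK`) (+ Cassels–Tate for the certificate
form). Census (engine A, `N < 2·10⁴`): X3 ∧ (M) ∧ `V` split ∧ ranks `(0,0)`: 148 CORE-open rows. Labels
UNCHANGED; nothing booked.
-/

noncomputable section

open scoped Classical MatrixGroups ModularForm

open CongruenceSubgroup WeierstrassCurve NumberField IsDedekindDomain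
  Literature.NumberTheory.EllipticCurves Literature.NumberTheory.EllipticCurves.ModularForms
  Literature.NumberTheory.EllipticCurves.Rank1Residual
  Literature.NumberTheory.EllipticCurves.Rank1Residual.Typed
  Literature.NumberTheory.GaloisRepresentations

namespace Summit.BirchSwinnertonDyer.Rank1Residual.Additive

/-! ## §1 `hGrK` from Greenberg's split display -/

section GreenbergK

variable (K : Type) [Field K] [NumberField K] [IsCyclotomicExtension {3} ℚ K]
  (V : WeierstrassCurve ℚ) [V.IsElliptic] [V.IsGloballyMinimal]

omit [V.IsGloballyMinimal] in
/-- `log₃ q_V ≠ 0` for a Tate parameter datum at `3` (from `𝓛₃(V) = log₃ q/ord₃ q ≠ 0`, tree theorem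
`LInvariant_ne_zero_holds`, Barré-Sirieix–Diaz–Gramain–Philibert 1996).
[cite: BarreSirieixDiazGramainPhilibert1996Manin, Thm. 1, Cor.] -/
theorem padicLog_tateParameter_ne_zero (Dq : TateParameterData V 3) : padicLog 3 Dq.q ≠ 0 := by
  intro h
  apply LInvariant_ne_zero_holds (W := V) (p := 3) Dq
  rw [LInvariant, h, zero_div]

/-- **Greenberg's Euler characteristic for `V_K`, `K = ℚ(ζ₃)`, at the SPLIT multiplicative prime above
`3`, in the `K`-shape of line V16** (the inline hypothesis `hGrK` of
`XSplitMultCyclotomicThree.exists_padicVal_shaOrder_add_le`), DERIVED from the named fact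
`Greenberg1999.thm41Analogue_charValue_rankZero_split_baseChange`: the only prime of `K` above `3` is
`𝔭 = (ζ₃ − 1)` (`N𝔭 = 3`, `e·f = 2·1` prime to `3`), `V_K` is split multiplicative there, and
`log₃ q_V ≠ 0`. [cite: GreenbergLNM1716, §4 pp. 112–113] -/
theorem XSplitMultCyclotomicThree.greenbergK_of_fact
    (hGr : Greenberg1999.thm41Analogue_charValue_rankZero_split_baseChange)
    (Dq : TateParameterData V 3) :
    ∀ (κ : ZpExtension K 3) (γ : Field.absoluteGaloisGroup K),
        κ.IsCyclotomic → κ.IsTopGenerator γ →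
      ∀ (D : (V.baseChange K).SelmerDualData κ γ) [Module.Finite (IwasawaAlgebra 3) D.X], D.IsTorsion →
      ∀ (fE : IwasawaAlgebra 3), D.charIdeal = Ideal.span {fE} →
        Finite ((V.baseChange K).selmerGroupPInfty 3) →
        ∃ u : ℤ_[3]ˣ,
          ((PowerSeries.constantCoeff fE : ℤ_[3]) : ℚ_[3]) *
              (Nat.card (AddCommGroup.primaryComponent (V.baseChange K).toAffine.Point 3) : ℚ_[3]) ^ 2 =
            ((u : ℤ_[3]) : ℚ_[3]) * (LInvariant Dq / (2 * (3 : ℚ_[3]))) *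
              (3 : ℚ_[3]) ^ (padicValNat 3 (V.baseChange K).tamagawaProduct) *
              (Nat.card ((V.baseChange K).selmerGroupPInfty 3) : ℚ_[3]) := by
  intro κ γ hκ hγ D _ hX fE hfE hfin
  obtain ⟨𝔭, h3, hS, hN⟩ := exists_prime_over_three K
  have hsplitK : (V.baseChange K).HasSplitMultiplicativeReductionAt 𝔭 :=
    hasSplitMultiplicativeReductionAt_baseChange_of_split V 𝔭 h3 hN Dq.split
  have hdeg := not_dvd_ramificationIdx_mul_inertiaDeg_cyclotomicThree K 𝔭 h3
  obtain ⟨u, hu⟩ := hGr.of_unique_prime V 3 Dq (by norm_num) (padicLog_tateParameter_ne_zero V Dq) 𝔭 hS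
    hsplitK hdeg κ γ hκ hγ D hX fE hfE hfin
  exact ⟨u, by rw [hu, Nat.cast_ofNat]⟩

end GreenbergK

/-! ## §2 The two tame branches at `T = 0` at a split multiplicative prime -/

section ConstantTerms

variable (p : ℕ) [hp : Fact p.Prime]

/-- **The ODD `χ_p`-branch of the one-term measure at `T = 0` (PROVED), split prime.** For `p ≠ 2`,
`V/ℚ` globally minimal with SPLIT multiplicative reduction at `p` (`a_p = 1`) and `f` its newform:
`constantCoeff (padicLFunctionMinusBranchMult f 1 ((p−1)/2)) = ∑_{a mod p} (a/p)·[a/p]⁻_f`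
(`= legendreMinusSymbolSum f p`; no exceptional zero on the odd branch). Twin of
`constantCoeff_padicLFunctionMinusBranchMult_half_of_nonsplit`. [cite: MazurTateTeitelbaum1986Invent, §I.10, §I.13–I.14] -/
theorem constantCoeff_padicLFunctionMinusBranchMult_half_of_split (hp2 : p ≠ 2) {N : ℕ} [NeZero N]
    {f : CuspForm (Gamma0 N) 2} (V : WeierstrassCurve ℚ) [V.IsElliptic] [V.IsGloballyMinimal]
    (hsplit : V.HasSplitMultiplicativeReductionAtPrime p) (hf : IsNewformOf V f) :
    PowerSeries.constantCoeff (padicLFunctionMinusBranchMult f (1 : ℚ_[p]) (p / 2)) =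
      (legendreMinusSymbolSum f p : ℚ_[p]) := by
  classical
  have hap : cuspCoeff f p = 1 := (hf.cuspCoeff_eq_one_and_sq_of_split hsplit).1
  have hpN : p ∣ N := hf.dvd_level_of_split hsplit
  have hdist0 := sum_fiber_msdMinusMeasureMult_succ_eq_of_coeffField (p := p) hf.1 hf.coeffField_eq_bot
    hpN (ap := 1) (by rw [hap]; norm_num) (by norm_num)
  have hcast : ((1 : ℤ) : ℚ_[p]) = 1 := by norm_num
  rw [hcast] at hdist0
  rw [constantCoeff_padicLFunctionMinusBranchMult_eq hdist0 (p / 2)]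
  have hsummand : ∀ a : (ZMod (p ^ cyclotomicExponent p))ˣ,
      msdMinusMeasureMult f (1 : ℚ_[p]) (cyclotomicExponent p) (a : ZMod (p ^ cyclotomicExponent p)) *
          ((((teichRep p a : rootsOfUnity (torsionOrder p) ℤ_[p]) : ℤ_[p]ˣ) : ℤ_[p]) : ℚ_[p]) ^
            (p / 2) =
        (((legendreSym p ((a : ZMod (p ^ cyclotomicExponent p)).val : ℤ)) : ℚ_[p]) *
            (ratMinusSymbol f (((a : ZMod (p ^ cyclotomicExponent p)).val : ℚ) / p) : ℚ_[p])) := by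
    intro a
    have hteich : ((((teichRep p a : rootsOfUnity (torsionOrder p) ℤ_[p]) : ℤ_[p]ˣ) : ℤ_[p]) :
        ℚ_[p]) ^ (p / 2) =
        (legendreSym p ((a : ZMod (p ^ cyclotomicExponent p)).val : ℤ) : ℚ_[p]) := by
      rw [← PadicInt.coe_pow, teichRep_pow_half_eq_legendreSym p hp2 a, PadicInt.coe_intCast]
    have he : cyclotomicExponent p = 1 := cyclotomicExponent_eq_one p hp2
    have h2 : ((p : ℚ)) ^ cyclotomicExponent p = p := by rw [he, pow_one]
    rw [hteich, msdMinusMeasureMult, inv_one, one_pow, one_mul, h2]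
    ring
  rw [Fintype.sum_congr _ _ hsummand]
  rw [sum_units_cyclotomicExponent_eq p hp2
    (fun n : ℕ ↦ (legendreSym p (n : ℤ) : ℚ_[p]) * (ratMinusSymbol f ((n : ℚ) / p) : ℚ_[p]))
    (fun n hn ↦ by
      rw [(legendreSym.eq_zero_iff p (n : ℤ)).mpr (by exact_mod_cast (ZMod.natCast_eq_zero_iff n p).mpr hn)]
      push_cast
      ring)]
  rw [legendreMinusSymbolSum_def]
  push_cast
  rfl

/-- **At `p = 3`, split prime**: `constantCoeff (padicLFunctionMinusBranchMult f 1 1) = e⁻ · legendreMinusSymbolSum f 3`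
with `e⁻ = 1` — the hypothesis `hLm0` of the V16 core. [cite: MazurTateTeitelbaum1986Invent, §I.13–I.14] -/
theorem constantCoeff_padicLFunctionMinusBranchMult_one_three_of_split {N : ℕ} [NeZero N]
    {f : CuspForm (Gamma0 N) 2} (V : WeierstrassCurve ℚ) [V.IsElliptic] [V.IsGloballyMinimal]
    (hsplit : V.HasSplitMultiplicativeReductionAtPrime 3) (hf : IsNewformOf V f) :
    PowerSeries.constantCoeff (padicLFunctionMinusBranchMult f (1 : ℚ_[3]) 1) =
      (((1 : ℤ_[3]ˣ) : ℤ_[3]) : ℚ_[3]) * (legendreMinusSymbolSum f 3 : ℚ_[3]) := by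
  have h := constantCoeff_padicLFunctionMinusBranchMult_half_of_split 3 (by norm_num) V hsplit hf
  rw [show (3 : ℕ) / 2 = 1 from rfl] at h
  rw [h]
  push_cast
  ring

/-- **The EVEN branch at the split prime (Greenberg–Stevens)**: for THE function `L` with
`IsSplitMultPAdicLFunctionOf f 3 L`: `L(0) = 0` and `[T¹]L · log₃ γ_cyc = e⁺ · 𝓛₃(V) · [0]⁺_f` with
`e⁺ = 1` — the hypotheses `hLp0`, `hLp1` of the V16 core, from the named fact `greenberg_stevens V 3`
(Kobayashi 2006 Cor. 4.2). [cite: Kobayashi2006DocMath, Cor. 4.2 (p. 575)] -/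
theorem constantCoeff_and_coeff_one_of_greenbergStevens {V : WeierstrassCurve ℚ} [V.IsElliptic]
    [V.IsGloballyMinimal] (hGS : greenberg_stevens V 3) (Dq : TateParameterData V 3)
    {N : ℕ} [NeZero N] {f : CuspForm (Gamma0 N) 2} (hf : IsNewformOf V f)
    {L : PowerSeries ℚ_[3]} (hL : IsSplitMultPAdicLFunctionOf f 3 L) :
    PowerSeries.constantCoeff L = 0 ∧
      PowerSeries.coeff 1 L * padicLog 3 (cyclotomicGenerator 3 : ℚ_[3]) =
        (((1 : ℤ_[3]ˣ) : ℤ_[3]) : ℚ_[3]) * LInvariant Dq * (ratPlusSymbol f 0 : ℚ_[3]) := by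
  obtain ⟨h0, h1⟩ := hGS Dq hf hL
  refine ⟨h0, ?_⟩
  rw [h1]
  push_cast
  ring

end ConstantTerms

/-! ## §3 X3: `V[3]` reducible — Wuthrich Thm. 16, split clause, over `ℚ(ζ₃)` -/

section X3Facts

variable (V : WeierstrassCurve ℚ) [V.IsElliptic] [V.IsGloballyMinimal]
  (W : WeierstrassCurve ℚ) [W.IsElliptic] [W.IsGloballyMinimal]

/-- **Line V16 (X3 (M)-rows, `V` split, `p = 3`), core inequality, from named facts only.** Let `V/ℚ`
be globally minimal with SPLIT multiplicative reduction at `3` and `V[3]` REDUCIBLE, and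
`W = C • V^{(−3)}` a globally minimal model of its twist by `−3`, ADDITIVE at `3`, both of analytic rank
`0`. Then `#Ш_an(V) = q_V`, `#Ш_an(W) = q_W` are rationals with
**`ord₃ #Ш(V) + ord₃ #Ш(W) ≤ ord₃ q_V + ord₃ q_W`**, granted EXACTLY: Wuthrich 2014 Thm. 16, split
clause, over `ℚ(ζ₃)` (`hW16`), Greenberg LNM 1716 pp. 112–113 at a split prime (`hGr`),
Greenberg–Stevens (`hGS`), Milne 1972 (`hMilne`), modularity (`hmod`, `hmodD`), GZK (`hGZK`). The Tate
parameter (`nonempty_tateParameterData_iff_holds`), `𝓛₃(V) ≠ 0` (`LInvariant_ne_zero_holds`), the even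
branch (`exists_isSplitMultPAdicLFunctionOf`) and `ord₃ log₃ γ = 1` are THEOREMS.
[cite: Wuthrich2014, Thm. 16 (p. 397)] [cite: GreenbergLNM1716, §4 pp. 112–113]
[cite: Kobayashi2006DocMath, Cor. 4.2 (p. 575)] [cite: Milne1972ArithmeticAV, §1 Thm. 1] -/
theorem XSplitMultCyclotomicThree.exists_padicVal_shaOrder_add_le_of_facts_of_red
    (hW16 : Wuthrich2014.thm16_charIdeal_dvd_splitMultiplicative_cyclotomicThree)
    (hGr : Greenberg1999.thm41Analogue_charValue_rankZero_split_baseChange)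
    (hGS : greenberg_stevens V 3)
    (hMilne : Milne1972.bsdQuotient_baseChange_quadratic_anyModel)
    (hGZK : rank_eq_analyticRank_of_analyticRank_le_one) (hmod : hasEntireLFunction_rat)
    (hmodD : nonempty_modularParametrizationData)
    (C : VariableChange ℚ) (hC : C • V.quadraticTwist (-(3 : ℚ)) = W)
    (hsplit : V.HasSplitMultiplicativeReductionAtPrime 3) (hred : ¬ V.HasIrreducibleModPGaloisRep 3)
    (hadd : Addv W 3) (hrV : V.analyticRank = 0) (hrW : W.analyticRank = 0) :
    ∃ qV qW : ℚ, shaAn V = (qV : ℂ) ∧ shaAn W = (qW : ℂ) ∧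
      (padicValNat 3 V.shaOrder : ℤ) + padicValNat 3 W.shaOrder ≤ padicValRat 3 qV + padicValRat 3 qW := by
  haveI : IsCyclotomicExtension {3} ℚ (CyclotomicField 3 ℚ) := CyclotomicField.isCyclotomicExtension 3 ℚ
  set K := CyclotomicField 3 ℚ
  obtain ⟨Dq⟩ := (nonempty_tateParameterData_iff_holds (W := V) (p := 3)).mpr hsplit
  have hLinv : LInvariant Dq ≠ 0 := LInvariant_ne_zero_holds (W := V) (p := 3) Dq
  haveI : NeZero (V.conductorNorm ℤ) := ⟨(V.conductorNorm_pos_holds).ne'⟩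
  obtain ⟨Dm⟩ := hmodD V
  have hf : IsNewformOf V Dm.f := Dm.isNewformOf
  obtain ⟨ϖ, -, hϖ, -⟩ := Dm.exists_rat_mul_realPeriodRat_eq_plusPeriod
  obtain ⟨ϖ', -, hϖ'⟩ := exists_rat_mul_imaginaryPeriodRat_eq_minusPeriod Dm
  obtain ⟨Lp, hLp⟩ := exists_isSplitMultPAdicLFunctionOf hsplit hf
  obtain ⟨hLp0, hLp1⟩ := constantCoeff_and_coeff_one_of_greenbergStevens hGS Dq hf hLp
  have hLm0 := constantCoeff_padicLFunctionMinusBranchMult_one_three_of_split V hsplit hf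
  refine XSplitMultCyclotomicThree.exists_padicVal_shaOrder_add_le K V W hGZK hmod hMilne C hC Dq hLinv
    hadd hrV hrW hf ϖ ϖ' hϖ hϖ' Lp (padicLFunctionMinusBranchMult Dm.f (1 : ℚ_[3]) 1) 1 1 hLp0 hLp1 hLm0
    (fun κ γ hκ hγ hγ' D ↦ ?_) (XSplitMultCyclotomicThree.greenbergK_of_fact K V hGr Dq)
  exact hW16 V K (V.baseChange K) hsplit hred ⟨1, one_smul _ _⟩ hκ hγ hγ' hf D ϖ ϖ' hϖ hϖ' Lp hLp

/-- **The cell's typed UPPER half for the additive X3 (M)-curve with split twist, from named facts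
only**: in the situation of `…_of_facts_of_red`, if `#Ш_an(V)` has non-positive `3`-adic valuation then
`Typed.MissingUpperBoundAt W 3`. [cite: Wuthrich2014, Thm. 16 (p. 397)] [cite: GreenbergLNM1716, §4 pp. 112–113] -/
theorem XSplitMultCyclotomicThree.missingUpperBoundAt_of_facts_of_red
    (hW16 : Wuthrich2014.thm16_charIdeal_dvd_splitMultiplicative_cyclotomicThree)
    (hGr : Greenberg1999.thm41Analogue_charValue_rankZero_split_baseChange)
    (hGS : greenberg_stevens V 3)
    (hMilne : Milne1972.bsdQuotient_baseChange_quadratic_anyModel)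
    (hGZK : rank_eq_analyticRank_of_analyticRank_le_one) (hmod : hasEntireLFunction_rat)
    (hmodD : nonempty_modularParametrizationData)
    (C : VariableChange ℚ) (hC : C • V.quadraticTwist (-(3 : ℚ)) = W)
    (hsplit : V.HasSplitMultiplicativeReductionAtPrime 3) (hred : ¬ V.HasIrreducibleModPGaloisRep 3)
    (hadd : Addv W 3) (hrV : V.analyticRank = 0) (hrW : W.analyticRank = 0)
    {qV : ℚ} (hqV : shaAn V = (qV : ℂ)) (hv : padicValRat 3 qV ≤ 0) :
    MissingUpperBoundAt W 3 := by
  obtain ⟨qV', qW, hqV', hqW, hle⟩ := XSplitMultCyclotomicThree.exists_padicVal_shaOrder_add_le_of_facts_of_red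
    V W hW16 hGr hGS hMilne hGZK hmod hmodD C hC hsplit hred hadd hrV hrW
  have hqq : qV' = qV := by exact_mod_cast hqV'.symm.trans hqV
  subst hqq
  refine ⟨qW, hqW, ?_⟩
  have h0 : (0 : ℤ) ≤ padicValNat 3 V.shaOrder := by positivity
  linarith

/-- **`BSD(W,3) ∧ BSD(V,3)` on the doubly-unit X3 (M)-rows with split twist, from named facts only**:
`#Ш_an(V)` and `#Ш_an(W)` `3`-adic units ⇒ Miller's `BSD(W,3)` and `BSD(V,3)` — for the ADDITIVE X3 pair
`(W,3)` (type `I_n*`, `W[3]` reducible, `v₃(j) < 0`) and its split multiplicative Eisenstein twist pair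
`(V,3)` simultaneously. Census (engine A, `N < 2·10⁴`): 148 CORE-open rank-`(0,0)` X3 ∧ (M) ∧ split
rows. Labels UNCHANGED; nothing booked by this theorem.
[cite: Wuthrich2014, Thm. 16 (p. 397)] [cite: GreenbergLNM1716, §4 pp. 112–113]
[cite: Kobayashi2006DocMath, Cor. 4.2 (p. 575)] [cite: Milne1972ArithmeticAV, §1 Thm. 1] -/
theorem XSplitMultCyclotomicThree.bsdp_of_shaAn_units_of_facts_of_red
    (hW16 : Wuthrich2014.thm16_charIdeal_dvd_splitMultiplicative_cyclotomicThree)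
    (hGr : Greenberg1999.thm41Analogue_charValue_rankZero_split_baseChange)
    (hGS : greenberg_stevens V 3)
    (hMilne : Milne1972.bsdQuotient_baseChange_quadratic_anyModel)
    (hGZK : rank_eq_analyticRank_of_analyticRank_le_one) (hmod : hasEntireLFunction_rat)
    (hmodD : nonempty_modularParametrizationData)
    (C : VariableChange ℚ) (hC : C • V.quadraticTwist (-(3 : ℚ)) = W)
    (hsplit : V.HasSplitMultiplicativeReductionAtPrime 3) (hred : ¬ V.HasIrreducibleModPGaloisRep 3)
    (hadd : Addv W 3) (hrV : V.analyticRank = 0) (hrW : W.analyticRank = 0)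
    {qV qW : ℚ} (hqV : shaAn V = (qV : ℂ)) (hqW : shaAn W = (qW : ℂ))
    (hvV : padicValRat 3 qV = 0) (hvW : padicValRat 3 qW = 0) : BSDp W 3 ∧ BSDp V 3 := by
  obtain ⟨qV', qW', hqV', hqW', hle⟩ :=
    XSplitMultCyclotomicThree.exists_padicVal_shaOrder_add_le_of_facts_of_red V W hW16 hGr hGS hMilne hGZK
      hmod hmodD C hC hsplit hred hadd hrV hrW
  have hqq : qV' = qV := by exact_mod_cast hqV'.symm.trans hqV
  have hqq' : qW' = qW := by exact_mod_cast hqW'.symm.trans hqW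
  subst hqq hqq'
  rw [hvV, hvW, add_zero] at hle
  have hV0 : (0 : ℤ) ≤ padicValNat 3 V.shaOrder := by positivity
  have hW0 : (0 : ℤ) ≤ padicValNat 3 W.shaOrder := by positivity
  have huW : MissingUpperBoundAt W 3 := ⟨qW', hqW', by rw [hvW]; linarith⟩
  have huV : MissingUpperBoundAt V 3 := ⟨qV', hqV', by rw [hvV]; linarith⟩
  exact ⟨bsdp_of_missingPPartAt W 3 hGZK (by rw [hrW]; exact zero_le_one)
      (missingPPartAt_of_upper_of_shaAn_unit W 3 huW hqW' hvW),
    bsdp_of_missingPPartAt V 3 hGZK (by rw [hrV]; exact zero_le_one)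
      (missingPPartAt_of_upper_of_shaAn_unit V 3 huV hqV' hvV)⟩

/-- **The `3 ∣ #Ш_an(W)` rows (X3 ∧ (M) ∧ split): `BSD(W,3)` from ONE finite certificate, named facts
otherwise** (upper half above + Cassels–Tate squareness; `k = 1`: `Ш(W)[3] ≠ 0`).
[cite: Wuthrich2014, Thm. 16 (p. 397)] [cite: SilvermanAEC2009, Thm. X.4.14] [cite: Miller2011LMS, §1 and Def. 1.1] -/
theorem XSplitMultCyclotomicThree.bsdp_of_casselsTate_of_pow_dvd_of_facts_of_red
    (hW16 : Wuthrich2014.thm16_charIdeal_dvd_splitMultiplicative_cyclotomicThree)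
    (hGr : Greenberg1999.thm41Analogue_charValue_rankZero_split_baseChange)
    (hGS : greenberg_stevens V 3)
    (hMilne : Milne1972.bsdQuotient_baseChange_quadratic_anyModel)
    (hGZK : rank_eq_analyticRank_of_analyticRank_le_one) (hmod : hasEntireLFunction_rat)
    (hmodD : nonempty_modularParametrizationData) (hCT : exists_casselsTate_pairing (K := ℚ))
    (C : VariableChange ℚ) (hC : C • V.quadraticTwist (-(3 : ℚ)) = W)
    (hsplit : V.HasSplitMultiplicativeReductionAtPrime 3) (hred : ¬ V.HasIrreducibleModPGaloisRep 3)
    (hadd : Addv W 3) (hrV : V.analyticRank = 0) (hrW : W.analyticRank = 0)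
    {qV : ℚ} (hqV : shaAn V = (qV : ℂ)) (hvV : padicValRat 3 qV ≤ 0)
    {q : ℚ} (hq : shaAn W = (q : ℂ)) {k : ℕ} (hv : padicValRat 3 q ≤ 2 * k)
    (hdvd : 3 ^ (2 * k - 1) ∣ W.shaOrder) : BSDp W 3 :=
  bsdp_of_missingPPartAt W 3 hGZK (by rw [hrW]; exact zero_le_one)
    (missingPPartAt_of_lower_of_upper W 3
      (missingLowerBoundAt_of_casselsTate_of_pow_dvd W 3 hCT (hGZK W (by rw [hrW]; exact zero_le_one)).2
        hq hv hdvd)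
      (XSplitMultCyclotomicThree.missingUpperBoundAt_of_facts_of_red V W hW16 hGr hGS hMilne hGZK hmod hmodD
        C hC hsplit hred hadd hrV hrW hqV hvV))

end X3Facts

end Summit.BirchSwinnertonDyer.Rank1Residual.Additive

end
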